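import Literature.NumberTheory.DiophantineGeometry.KoizumiStrictlyLocal
import Literature.NumberTheory.DiophantineGeometry.KoizumiOfStrictlyLocal
import Literature.RingTheory.DiscreteValuationRing.StrictlyLocalExtension
import HarnessLib

/-!
# Koizumi's theorem at a place of a number field, modulo the two road-W heads (W0 core, W1 Weil chunk)
# — [Koizumi1960, p. 377] [BLRNeronModels1990, §1.2 Prop. 8, §5.1 Thm. 5, §6.5 Cor. 3] [Artin1986NeronModels, (1.12)]

Topic `Literature/NumberTheory/DiophantineGeometry`; THEOREMS ONLY; net Literature debt 0.  Cell `hodgecm-mathlib` (D-0151), road W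
(r₀ as a theorem, banked Néron capital; sub-line `koizumi_strictly_local` of the frozen `Cruxes/H21/Lines/r0_koizumi.lean`, B-plan1).
This file is the LAST composition of the road: the strictly-local closer `koizumiStrictlyLocal_of_v6 (hW0) (hW1)` ★ p641474 (A-p14;
(W1) head in its v6 text), the descent step (W4) `koizumi_of_koizumiStrictlyLocal_of_strictlyLocalCover` ★ p632399 (A-p14) and the
strictly-local cover (W5) `exists_complete_dvr_faithfullyFlat_unramified_isAlgClosed` ★ p630952 (B-p03) compose to Koizumi's theorem
at every finite place `v` of a number field `K`, for every abelian variety `A / K` and every smooth proper integral model with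
geometrically irreducible fibres handled inside (W4): **modulo exactly the two heads `hW0` ((W0) core, B-p18 table) and `hW1` ((W1) Weil
group chunk over a strictly henselian base, v6 text, A-p06 table)**, whose binder texts are those of `koizumiStrictlyLocal_of_v6` at
universe `0`.  When the two heads land as theorems, `koizumi_reductionAt_of_roadW hW0 hW1` applied to them is Koizumi unconditionally.
HC_CM is proved only modulo the 7 printed citations until rung 0 closes; road W is banked capital (0 floor distance).
-/

set_option autoImplicit false

noncomputable section

universe u

open CategoryTheory CategoryTheory.Limits AlgebraicGeometry MonoidalCategory CartesianMonoidalCategory MonObj GrpObj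
open scoped CategoryTheory.Obj
open IsDedekindDomain IsDedekindDomain.HeightOneSpectrum
open scoped NumberField
open Literature Literature.AlgebraicGeometry.Motives Literature.NumberTheory.EllipticCurves
  Literature.AlgebraicGeometry.GroupSchemes Literature.RingTheory.DiscreteValuationRing

namespace Literature.NumberTheory.DiophantineGeometry

/-- **Koizumi's theorem at a finite place, modulo (W0) and (W1)** ([Koizumi1960, Thm. p. 377]; [BLRNeronModels1990, §1.2
Prop. 8 with §5.1 Thm. 5 and §6.5 Cor. 3]): given the two road-W heads in the texts of `koizumiStrictlyLocal_of_v6` (universe `0`),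
for a number field `K`, an abelian variety `A / K`, a finite place `v` and an integral model `𝒳` of `A.X` over `𝓞_{K,(v)}` that is
smooth of relative dimension `dim A` and proper, the total space of `𝒳` carries an `𝓞_{K,(v)}`-group-scheme structure making it
an abelian-scheme model of `A` at `v`.  Proof: (W5) cover ★ + strictly-local closer ★ fed to the descent step (W4) ★.
[cite: Koizumi1960, Thm. p. 377] [cite: BLRNeronModels1990, §1.2 Prop. 8, §5.1 Thm. 5, §6.5 Cor. 3]
[cite: Artin1986NeronModels, (1.12)] -/
theorem koizumi_reductionAt_of_roadW
    (hW0 : ∀ (R : Type) [CommRing R] [IsDomain R] [IsDiscreteValuationRing R]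
      (K : Type) [Field K] [Algebra R K] [IsFractionRing R K]
      (𝒳 : Over (Spec (.of R))) [Smooth 𝒳.hom] [IsProper 𝒳.hom] [GeometricallyIrreducible 𝒳.hom]
      (E : Over (Spec (.of K))) [GrpObj E] (e : (genericFibre R K).obj 𝒳 ≅ E),
      ∃ (U : (𝒳 ⊗ 𝒳).left.Opens) (m : (U : Scheme.{0}) ⟶ 𝒳.left)
        (hm : m ≫ 𝒳.hom = U.ι ≫ (𝒳 ⊗ 𝒳).hom),
        (𝒳 ⊗ 𝒳).hom.base ⁻¹' Set.range (specGenericPoint R K).base ⊆ (U : Set (𝒳 ⊗ 𝒳).left) ∧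
        (∃ u : (𝒳 ⊗ 𝒳).left, u ∈ U ∧ (𝒳 ⊗ 𝒳).hom.base u = IsLocalRing.closedPoint R) ∧
        (genericFibre R K).map (Over.homMk m hm : Over.mk (U.ι ≫ (𝒳 ⊗ 𝒳).hom) ⟶ 𝒳) ≫ e.hom =
          (genericFibre R K).map (Over.homMk U.ι rfl : Over.mk (U.ι ≫ (𝒳 ⊗ 𝒳).hom) ⟶ 𝒳 ⊗ 𝒳) ≫
            Functor.OplaxMonoidal.δ (genericFibre R K) 𝒳 𝒳 ≫ (e.hom ⊗ₘ e.hom) ≫ μ[E] ∧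
        (let Φ : Over.mk (U.ι ≫ (𝒳 ⊗ 𝒳).hom) ⟶ 𝒳 ⊗ 𝒳 :=
            lift (Over.homMk U.ι rfl ≫ fst 𝒳 𝒳) (Over.homMk m hm);
          IsOpenImmersion Φ.left ∧
            (𝒳 ⊗ 𝒳).hom.base ⁻¹' Set.range (specGenericPoint R K).base ⊆ Set.range Φ.left.base) ∧
        (let Ψ : Over.mk (U.ι ≫ (𝒳 ⊗ 𝒳).hom) ⟶ 𝒳 ⊗ 𝒳 :=
            lift (Over.homMk m hm) (Over.homMk U.ι rfl ≫ snd 𝒳 𝒳);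
          IsOpenImmersion Ψ.left ∧
            (𝒳 ⊗ 𝒳).hom.base ⁻¹' Set.range (specGenericPoint R K).base ⊆ Set.range Ψ.left.base))
    (hW1 : ∀ (R : Type) [CommRing R] [IsDomain R] [IsDiscreteValuationRing R] [HenselianLocalRing R]
      [IsAdicComplete (IsLocalRing.maximalIdeal R) R],
      IsAlgClosed (IsLocalRing.ResidueField R) →
      ∀ (𝒳 : Over (Spec (.of R))) [Smooth 𝒳.hom] [IsSeparated 𝒳.hom] [QuasiCompact 𝒳.hom]
        [GeometricallyIrreducible 𝒳.hom],
        ∀ L : BirationalGroupLaw 𝒳, L.IsStrict →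
          ∃ (G : Over (Spec (.of R))) (_ : GrpObj G) (j : 𝒳 ⟶ G),
            Smooth G.hom ∧ IsSeparated G.hom ∧ QuasiCompact G.hom ∧ IsGroupChunkSolution L G j)
    {K : Type} [Field K] [NumberField K] (A : AbelianVariety K) (v : HeightOneSpectrum (𝓞 K))
    (𝒳 : IntegralModel (valuationSubringAtPrime K v) K A.X) (h𝒳 : 𝒳.IsSmoothProper A.dim) :
    ∃ _ : GrpObj 𝒳.total, IsAbelianSchemeModel A v 𝒳.total :=
  koizumi_of_koizumiStrictlyLocal_of_strictlyLocalCover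
    (fun R' _ _ _ _ _ hk K' _ _ _ A' 𝒳' _ hsp => koizumiStrictlyLocal_of_v6 hW0 hW1 R' hk K' A' 𝒳' hsp)
    (fun R _ _ _ => exists_complete_dvr_faithfullyFlat_unramified_isAlgClosed R) A v 𝒳 h𝒳

end Literature.NumberTheory.DiophantineGeometry

end
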